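import Literature.NumberTheory.LFunctions.DeBruijnNewmanProofs
import Summits.QuantumFields.YangMills.Theorems.BalabanUVNodesN19LipBracketTube
import Summits.QuantumFields.YangMills.Theorems.BalabanUVNodesN19LipBracketNestedRadii

/-!
# BalabanUVNodes ∕ N19 — companion of `BalabanUVNodesN19LipBracketTube` (the hypothesis-only bracket (T) of
# `T4OutputRate.u3_threeBrackets` in the printed TUBE chart): the tube road SUBSUMES the tree's global-chart road with the
# constant HALVED, and NON-VACUITY of the pair-disc hypothesis set
# (cell `pub-ymgap`, HUMAN RULING D-0062 Track A, node N19 = NE7, R134 seat dag-n19-c g2, strategy s1′; count-neutral)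

HONEST FRAMING.  One fixed finite four-torus, rung (B)+1 — NOT infinite volume, NOT OS on ℝ⁴, NOT a mass gap, NOT the Clay
problem.  NE7 is NOT PRINTED and NOT proved here; N19 is NOT discharged; nothing of Bałaban's is instantiated.  THEOREMS
ONLY; 0 `def`; 0 `sorry`; standard axioms.  Split off `BalabanUVNodesN19LipBracketTube` under the 400-line rule; filed
`--supports` the K3 item `SpineGivenEndpointR11`; NOT a discharge claim.

CONTENTS.
* §5 **`pairDisc_of_analyticMargin`** — the data of the tree's Cauchy road
  `T4TowerRateDischarge.lipBackground_of_analyticMargin` (a chart `ι` of run-A backgrounds into a complex normed space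
  dominated by the gauge; an extension `Ec g X` holomorphic on a domain `D g X` with the (1.18) bound; CLOSED `ϱ`-balls about
  embedded backgrounds inside the domain; real agreement) GIVE the pair-disc shape of `N19LipBracketTube` §1 at the same
  radius: restrict `Ec g X` to the complex line `z ↦ ι U + (z∕δ)·(ι U′ − ι U)`, `δ = gauge U U′`.  Hence
  `lipBackground_of_analyticMargin_half` — the tree's conclusion under EXACTLY its hypotheses with the constant `2E₀∕ϱ` in
  place of `4E₀∕ϱ` (Schwarz on one disc instead of `Dimock2015.norm_sub_le_of_margin`) — and
  `lipBackground_of_nestedLevels_half` — `N19LipBracketNestedRadii.lipBackground_of_nestedLevels` likewise.  So every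
  instance of the global-chart road (knit v7 `N19MarginByName`, the nested-levels companion, the b2b transport chain) is an
  instance of the tube road; the converse is not claimed (the tube needs no chart at all).
* §6 **`toy_pairDisc`** — NON-VACUITY (toy data, no relation to Bałaban's objects): on `T4TowerRateComposition.toyCarriers`
  (domains `ℕ`, tree length `0`, backgrounds `ℝ`, gauge `|U − U′|`), window `univ`, `κ = 0`, radius `ϱ > 0`, functional
  `E₀e^{−ϱ}cos U`: the real decay bound holds with `E₀`, and for every pair `(U, U′)` the entire function
  `z ↦ E₀e^{−ϱ}cos(U + cz)`, `c = (U′ − U)∕|U′ − U|`, takes the two real values at `0` and `|U − U′|` and is bounded by `E₀`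
  on the disc `|z| < ϱ` (`‖cos w‖ ≤ e^{|Im w|}`, tree `Literature.NumberTheory.LFunctions.norm_cos_le_exp_abs_im`) — so the
  conclusion `LipBackground … (2E₀∕ϱ)` of `N19LipBracketTube.lipBackground_of_pairDisc` is inhabited.

CITATION HEADER (LOCATIONS only, as in `BalabanUVNodesN19LipBracketTube`; no decl below carries a cite tag).
[Balaban1987RG1] CMP **109** (1987) (1.13) p. 262, (1.17)–(1.18) p. 263; [Balaban1988Convergent] CMP **119** (1988)
(2.27)(ii)(iv), (2.28) p. 259, (2.39) p. 261; [DimockYuan2024GNFlow] proof of Thm 4 (the tree's Cauchy device).  Mathlib: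
`Complex.dist_le_div_mul_dist_of_mapsTo_ball`.
-/

open Metric Set

namespace Summit.QuantumFields.YangMills.BalabanUVNodes.N19LipBracketTubeWitness

open Literature.MathematicalPhysics.QuantumFieldTheory.Balaban1983to89
open T4OutputRate (Carriers Functional DecayBound LipBackground)
open T4TowerRateComposition (toyCarriers)
open T4TowerRateDischarge (decayBound_of_analyticMargin)
open Summit.QuantumFields.YangMills.BalabanUVNodes.N19LipBracketNestedRadii (creationMargin_of_nestedLevels)
open Summit.QuantumFields.YangMills.BalabanUVNodes.N19LipBracketTube (lipBackground_of_pairDisc)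

/-! ## §5 The tube road subsumes the tree's global-chart road (and halves its constant) -/

section Subsumes

variable {C : Carriers} {E : Type*} [NormedAddCommGroup E] [NormedSpace ℂ E]

/-- **GLOBAL CHART ⇒ PAIR DISCS.**  The data of `T4TowerRateDischarge.lipBackground_of_analyticMargin` — a chart `ι` of
run-A backgrounds into a complex normed space dominated by the gauge, an extension `Ec g X` holomorphic on a domain
`D g X` with the (1.18) bound, closed `ϱ`-balls about embedded backgrounds inside the domain, real agreement — GIVE the
pair-disc shape of §1 at the same radius: restrict `Ec g X` to the complex line `z ↦ ι U + (z∕δ)·(ι U′ − ι U)`,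
`δ = gauge U U′` (for `|z| < ϱ` the point is within `|z|·‖ι U′ − ι U‖∕δ ≤ |z|` of `ι U`; a degenerate pair `δ = 0` has
`ι U = ι U′` and the constant line).  So every instance of the tree's road (knit v7, the companion's nested levels, the b2b
transport chain) is an instance of the tube road. [folklore] -/
theorem pairDisc_of_analyticMargin {EA : Functional C C.BgA} {W : Set (ℕ → ℝ)} {κ E₀ : ℝ}
    (ι : C.BgA → E) (D : (ℕ → ℝ) → C.Dom → Set E) (ϱ : (ℕ → ℝ) → ℕ → ℝ) (Ec : (ℕ → ℝ) → C.Dom → E → ℂ)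
    (hhol : ∀ g ∈ W, ∀ X : C.Dom, DifferentiableOn ℂ (Ec g X) (D g X))
    (hbd : ∀ g ∈ W, ∀ X : C.Dom, ∀ z ∈ D g X, ‖Ec g X z‖ ≤ E₀ * Real.exp (-(κ * C.d X)))
    (hmargin : ∀ g ∈ W, ∀ (X : C.Dom) (U : C.BgA), closedBall (ι U) (ϱ g (C.scale X)) ⊆ D g X)
    (hreal : ∀ g ∈ W, ∀ (X : C.Dom) (U : C.BgA), Ec g X (ι U) = (EA g U X : ℂ))
    (hgauge : ∀ U U' : C.BgA, ‖ι U - ι U'‖ ≤ C.gauge U U') :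
    ∀ g ∈ W, ∀ (X : C.Dom) (U U' : C.BgA), C.gauge U U' < ϱ g (C.scale X) →
      ∃ f : ℂ → ℂ, DifferentiableOn ℂ f (ball (0 : ℂ) (ϱ g (C.scale X))) ∧ f 0 = (EA g U X : ℂ) ∧
        f (C.gauge U U' : ℂ) = (EA g U' X : ℂ) ∧
        ∀ z ∈ ball (0 : ℂ) (ϱ g (C.scale X)), ‖f z‖ ≤ E₀ * Real.exp (-(κ * C.d X)) := by
  intro g hg X U U' _
  have hδ0 : 0 ≤ C.gauge U U' := C.gauge_nonneg U U'
  have hv : ‖ι U' - ι U‖ ≤ C.gauge U U' := by rw [norm_sub_rev]; exact hgauge U U'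
  -- the complex line through `ι U` towards `ι U'`, parametrised by gauge length
  refine ⟨fun z => Ec g X (ι U + (z / (C.gauge U U' : ℂ)) • (ι U' - ι U)), ?_, ?_, ?_, ?_⟩
  · -- the line maps the disc into the domain
    have hmaps : MapsTo (fun z : ℂ => ι U + (z / (C.gauge U U' : ℂ)) • (ι U' - ι U)) (ball (0 : ℂ) (ϱ g (C.scale X)))
        (D g X) := by
      intro z hz
      refine hmargin g hg X U (ball_subset_closedBall ?_)
      rw [mem_ball, dist_zero_right] at hz
      rw [mem_ball, dist_eq_norm, add_sub_cancel_left, norm_smul, norm_div, Complex.norm_real, Real.norm_eq_abs,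
        abs_of_nonneg hδ0]
      refine lt_of_le_of_lt ?_ hz
      rcases hδ0.eq_or_lt with h0 | hpos
      · rw [← h0, div_zero, zero_mul]; exact norm_nonneg z
      · calc ‖z‖ / C.gauge U U' * ‖ι U' - ι U‖ ≤ ‖z‖ / C.gauge U U' * C.gauge U U' :=
            mul_le_mul_of_nonneg_left hv (div_nonneg (norm_nonneg _) hδ0)
          _ = ‖z‖ := div_mul_cancel₀ _ hpos.ne'
    exact (hhol g hg X).comp (by fun_prop) hmaps
  · simp only [zero_div, zero_smul, add_zero, hreal g hg X U]
  · rcases hδ0.eq_or_lt with h0 | hpos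
    · -- degenerate pair: the chart identifies the two backgrounds
      have hι : ι U = ι U' := by
        have h := hgauge U U'
        rw [← h0] at h
        exact eq_of_norm_sub_le_zero h
      simp only [← h0, Complex.ofReal_zero, div_zero, zero_smul, add_zero, hι, hreal g hg X U']
    · have hδne : (C.gauge U U' : ℂ) ≠ 0 := by exact_mod_cast hpos.ne'
      simp only [div_self hδne, one_smul, add_sub_cancel, hreal g hg X U']
  · intro z hz
    refine hbd g hg X _ (hmargin g hg X U (ball_subset_closedBall ?_))
    rw [mem_ball, dist_zero_right] at hz
    rw [mem_ball, dist_eq_norm, add_sub_cancel_left, norm_smul, norm_div, Complex.norm_real, Real.norm_eq_abs,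
      abs_of_nonneg hδ0]
    refine lt_of_le_of_lt ?_ hz
    rcases hδ0.eq_or_lt with h0 | hpos
    · rw [← h0, div_zero, zero_mul]; exact norm_nonneg z
    · calc ‖z‖ / C.gauge U U' * ‖ι U' - ι U‖ ≤ ‖z‖ / C.gauge U U' * C.gauge U U' :=
          mul_le_mul_of_nonneg_left hv (div_nonneg (norm_nonneg _) hδ0)
        _ = ‖z‖ := div_mul_cancel₀ _ hpos.ne'

/-- **THE TREE'S CAUCHY ROAD RE-DERIVED WITH THE CONSTANT HALVED**: under EXACTLY the hypotheses of
`T4TowerRateDischarge.lipBackground_of_analyticMargin` (conclusion there: `4E₀∕ϱ`, via `Dimock2015.norm_sub_le_of_margin`),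
`LipBackground EA W κ (2E₀∕ϱ)` — §5's pair discs fed to §1 (the real bound by the tree's `decayBound_of_analyticMargin`).
[folklore] -/
theorem lipBackground_of_analyticMargin_half {EA : Functional C C.BgA} {W : Set (ℕ → ℝ)} {κ E₀ : ℝ}
    (ι : C.BgA → E) (D : (ℕ → ℝ) → C.Dom → Set E) (ϱ : (ℕ → ℝ) → ℕ → ℝ) (Ec : (ℕ → ℝ) → C.Dom → E → ℂ)
    (hϱ : ∀ g ∈ W, ∀ j, 0 < ϱ g j)
    (hhol : ∀ g ∈ W, ∀ X : C.Dom, DifferentiableOn ℂ (Ec g X) (D g X))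
    (hbd : ∀ g ∈ W, ∀ X : C.Dom, ∀ z ∈ D g X, ‖Ec g X z‖ ≤ E₀ * Real.exp (-(κ * C.d X)))
    (hmargin : ∀ g ∈ W, ∀ (X : C.Dom) (U : C.BgA), closedBall (ι U) (ϱ g (C.scale X)) ⊆ D g X)
    (hreal : ∀ g ∈ W, ∀ (X : C.Dom) (U : C.BgA), Ec g X (ι U) = (EA g U X : ℂ))
    (hgauge : ∀ U U' : C.BgA, ‖ι U - ι U'‖ ≤ C.gauge U U') :
    LipBackground EA W κ (fun g j => 2 * E₀ / ϱ g j) :=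
  lipBackground_of_pairDisc hϱ (decayBound_of_analyticMargin ι D ϱ Ec hϱ hbd hmargin hreal)
    (pairDisc_of_analyticMargin ι D ϱ Ec hhol hbd hmargin hreal hgauge)

/-- **THE COMPANION'S NESTED-LEVELS ROAD, CONSTANT HALVED**: under EXACTLY the hypotheses of
`N19LipBracketNestedRadii.lipBackground_of_nestedLevels` (conclusion there: `4E₀∕ϱ` at the derived margin
`ϱ = (α − ε)∕(2Λ)`), `LipBackground EA W κ (2E₀∕ϱ)` — its creation margin `creationMargin_of_nestedLevels` fed to
`lipBackground_of_analyticMargin_half`. [folklore] -/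
theorem lipBackground_of_nestedLevels_half {EA : Functional C C.BgA} {W : Set (ℕ → ℝ)} {κ E₀ Λ : ℝ}
    (ι : C.BgA → E) (D : (ℕ → ℝ) → C.Dom → Set E) (dev : (ℕ → ℝ) → C.Dom → E → ℝ)
    (α ε : (ℕ → ℝ) → ℕ → ℝ) (Ec : (ℕ → ℝ) → C.Dom → E → ℂ)
    (hspace : ∀ g ∈ W, ∀ X : C.Dom, {z | dev g X z < α g (C.scale X)} ⊆ D g X)
    (hhol : ∀ g ∈ W, ∀ X : C.Dom, DifferentiableOn ℂ (Ec g X) (D g X))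
    (hbd : ∀ g ∈ W, ∀ X : C.Dom, ∀ z ∈ D g X, ‖Ec g X z‖ ≤ E₀ * Real.exp (-(κ * C.d X)))
    (hreal : ∀ g ∈ W, ∀ (X : C.Dom) (U : C.BgA), Ec g X (ι U) = (EA g U X : ℂ))
    (hLip : ∀ g ∈ W, ∀ (X : C.Dom) (U : C.BgA) (z : E),
      ‖z - ι U‖ ≤ (α g (C.scale X) - ε g (C.scale X)) / (2 * Λ) → dev g X z ≤ dev g X (ι U) + Λ * ‖z - ι U‖)
    (hΛ : 0 < Λ)
    (hlevel : ∀ g ∈ W, ∀ (X : C.Dom) (U : C.BgA), dev g X (ι U) ≤ ε g (C.scale X))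
    (hgap : ∀ g ∈ W, ∀ j, ε g j < α g j)
    (hgauge : ∀ U U' : C.BgA, ‖ι U - ι U'‖ ≤ C.gauge U U') :
    LipBackground EA W κ (fun g j => 2 * E₀ / ((α g j - ε g j) / (2 * Λ))) :=
  lipBackground_of_analyticMargin_half ι D (fun g j => (α g j - ε g j) / (2 * Λ)) Ec
    (fun g hg j => div_pos (sub_pos.mpr (hgap g hg j)) (by positivity)) hhol hbd
    (fun g hg X U => creationMargin_of_nestedLevels (hspace g hg X) (hLip g hg X U) (hlevel g hg X U) hΛ
      (hgap g hg _))
    hreal hgauge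

end Subsumes

/-! ## §6 Non-vacuity: every hypothesis of `lipBackground_of_pairDisc` met on the tree's toy carriers -/

section Toy

/-- **NON-VACUITY** (toy data, no relation to Bałaban's objects).  On `T4TowerRateComposition.toyCarriers` (domains `ℕ`,
tree length `0`, backgrounds `ℝ`, gauge `|U − U′|`) with the window `univ`, `κ = 0`, a radius `ϱ > 0` and the functional
`E₀e^{−ϱ}cos U`: the real decay bound holds with `E₀`, and for every pair `(U, U′)` the function
`z ↦ E₀e^{−ϱ}cos(U + cz)`, `c = (U′ − U)∕|U′ − U|`, is entire, takes the two real values at `0` and `|U − U′|`, and is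
bounded by `E₀` on the disc `|z| < ϱ` (`‖cos w‖ ≤ e^{|Im w|}`, tree `Literature.NumberTheory.LFunctions.norm_cos_le_exp_abs_im`)
— so §1's conclusion `LipBackground … (2E₀∕ϱ)` is inhabited. [folklore] -/
theorem toy_pairDisc {ϱ E₀ : ℝ} (hϱ : 0 < ϱ) (hE₀ : 0 ≤ E₀) :
    LipBackground (C := toyCarriers) (fun _ (U : ℝ) _ => E₀ * Real.exp (-ϱ) * Real.cos U) Set.univ 0
      (fun _ _ => 2 * E₀ / ϱ) := by
  have hK0 : 0 ≤ E₀ * Real.exp (-ϱ) := mul_nonneg hE₀ (Real.exp_pos _).le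
  refine lipBackground_of_pairDisc (C := toyCarriers) (ϱ := fun _ _ => ϱ) (fun _ _ _ => hϱ) ?_ ?_
  · -- the real decay bound with `E₀` (`d ≡ 0`, `κ = 0`)
    intro s _ U X
    show |E₀ * Real.exp (-ϱ) * Real.cos U| ≤ E₀ * Real.exp (-(0 * (0 : ℝ)))
    rw [abs_mul, abs_of_nonneg hK0]
    simp only [mul_zero, neg_zero, Real.exp_zero, mul_one]
    calc E₀ * Real.exp (-ϱ) * |Real.cos U| ≤ E₀ * Real.exp (-ϱ) * 1 :=
          mul_le_mul_of_nonneg_left (Real.abs_cos_le_one U) hK0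
      _ ≤ E₀ * 1 * 1 := by
          gcongr
          exact Real.exp_le_one_iff.mpr (by linarith)
      _ = E₀ := by ring
  · -- the pair discs
    intro s _ X U U' _
    set c : ℝ := (U' - U) / |U' - U| with hcdef
    have hc1 : |c| ≤ 1 := by
      rw [hcdef, abs_div, abs_abs]
      exact div_self_le_one _
    have hcU : c * |U - U'| = U' - U := by
      rw [abs_sub_comm, hcdef]
      rcases eq_or_ne (U' - U) 0 with h0 | hne
      · simp [h0]
      · exact div_mul_cancel₀ _ (abs_ne_zero.mpr hne)
    refine ⟨fun z => ((E₀ * Real.exp (-ϱ) : ℝ) : ℂ) * Complex.cos ((U : ℂ) + (c : ℂ) * z), ?_, ?_, ?_, ?_⟩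
    · exact (((Complex.differentiable_cos.comp (by fun_prop))).const_mul _).differentiableOn
    · show ((E₀ * Real.exp (-ϱ) : ℝ) : ℂ) * Complex.cos ((U : ℂ) + (c : ℂ) * 0) =
        ((E₀ * Real.exp (-ϱ) * Real.cos U : ℝ) : ℂ)
      push_cast
      ring_nf
    · show ((E₀ * Real.exp (-ϱ) : ℝ) : ℂ) * Complex.cos ((U : ℂ) + (c : ℂ) * ((|U - U'| : ℝ) : ℂ)) =
        ((E₀ * Real.exp (-ϱ) * Real.cos U' : ℝ) : ℂ)
      have e : (U : ℂ) + (c : ℂ) * ((|U - U'| : ℝ) : ℂ) = ((U' : ℝ) : ℂ) := by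
        rw [← Complex.ofReal_mul, hcU]; push_cast; ring
      rw [e]
      push_cast
      ring
    · intro z hz
      have hz' : ‖z‖ < ϱ := by rwa [mem_ball, dist_zero_right] at hz
      have him : |((U : ℂ) + (c : ℂ) * z).im| ≤ ϱ := by
        simp only [Complex.add_im, Complex.ofReal_im, Complex.mul_im, Complex.ofReal_re, zero_mul, add_zero,
          zero_add]
        rw [abs_mul]
        calc |c| * |z.im| ≤ 1 * ‖z‖ :=
              mul_le_mul hc1 (Complex.abs_im_le_norm z) (abs_nonneg _) zero_le_one
          _ ≤ ϱ := by rw [one_mul]; exact hz'.le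
      have hcos : ‖Complex.cos ((U : ℂ) + (c : ℂ) * z)‖ ≤ Real.exp ϱ :=
        (Literature.NumberTheory.LFunctions.norm_cos_le_exp_abs_im _).trans (Real.exp_le_exp.mpr him)
      show ‖((E₀ * Real.exp (-ϱ) : ℝ) : ℂ) * Complex.cos ((U : ℂ) + (c : ℂ) * z)‖ ≤ E₀ * Real.exp (-(0 * (0 : ℝ)))
      rw [norm_mul, Complex.norm_real, Real.norm_eq_abs, abs_of_nonneg hK0]
      simp only [mul_zero, neg_zero, Real.exp_zero, mul_one]
      calc E₀ * Real.exp (-ϱ) * ‖Complex.cos ((U : ℂ) + (c : ℂ) * z)‖ ≤ E₀ * Real.exp (-ϱ) * Real.exp ϱ :=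
            mul_le_mul_of_nonneg_left hcos hK0
        _ = E₀ := by rw [mul_assoc, ← Real.exp_add]; simp

end Toy

end Summit.QuantumFields.YangMills.BalabanUVNodes.N19LipBracketTubeWitness
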